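import Summits.Ventures.CertifiedManyBodySolver.Observables.RungLeavesCoverage
import Summits.Ventures.CertifiedManyBodySolver.Downfold.BoxesNdNiO2EStiffnessKinematic
import HarnessLib

/-!
# Ventures/CertifiedManyBodySolver — Observables/RungLeavesCoverageNdNiO2.lean

HONEST FRAMING: one-sided certified CEILINGS on the uniform flux stiffness on the DOWNFOLDED nickelate boxes `boxNdNiO2E_M21` (NdNiO₂ parent film)
and `boxNdSrNiO2E_M22` (Nd₀.₈Sr₀.₂NiO₂) — wording class (xx1): CONTROL / CALIBRATION + labelled heuristic; a ceiling never speaks to the presence of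
superconductivity; a downfolded box is a systematic modelling claim (words of record «1BH+3BE», router/BOXES/NdNiO2.md, BOX #20); never «certified true
negative / positive»; not a `T_c` or phase-diagram statement. Typing certifies nothing about any material; no number of record is asserted here.

Cell `pub/hubbard-obs` (MO-S2, D-0154 (1)(C) COVERAGE: NdNiO₂), seat `hubbard-cov-ndnio2-box-2` (`prover-hubbard-cov-ndnio2-box-2-0`). Companion of
`Observables/RungLeavesCoverage.lean` §4 (the rung leaves `NdNiO2M21_StiffnessBoxCeiling` — bar `0.4779578 = 0.98 × κ₂₁`, `κ₂₁ = 0.4877121` — and the twin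
`NdNiO2M22_StiffnessBoxCeiling`, bar `0.4418857`) holding, for the NdNiO₂ box `U/t ∈ [5, 17/2] × t′/t ∈ [−23/50, −9/25] × n ∈ [213/250, 477/500]`:

* the KINEMATIC CONTROLS (node-free, zero solve): the obligation shape is inhabited at the kinematic bar — `StiffnessBoxCeilingBelow boxNdNiO2E_M21 (4877121/10⁷)`
  from the box word `Downfold.boxNdNiO2E_M21_stiffness_kinematic` (hubbard-tc p1's kernel leaf `ndBoxE_parentM21col_stiffnessSeqLeaf`), and the M22 twin at
  `4509038/10⁷`; the rung leaves ask for `2 %` less (`ndnio2_M21_bar_arith`), which kinematics does NOT deliver — interaction content is required at the binding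
  corner `(U, t′, n) = (5, −0.46, 0.954)` (engine preview `0.4809983`, `0.63 %` above the bar);
* the one-station geometry at the low-`U` edge `U_A = 5` (`ndnio2_M21_station5_geometry`: factor `2 − 5/(17/2) = 24/17`, far source `(−23/50)(24/17) = −276/425
  ≈ −0.6494`, inner `(−9/25)(24/17) = −216/425 ≈ −0.5082`);
* the DISCHARGERS transposed from the Hg-1201 §2/§3 closers of `RungLeavesCoverage.lean`, each BAR-PARAMETRIC (`StiffnessBoxCeilingBelow boxNdNiO2E_M21 bar`
  for any `bar ≥ c`, so a director bar re-uses them) plus the leaf instance at `4779578/10⁷`: ONE STATION `U_A = 5` read with the TWO END objectives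
  `−X₀(−23/50, 5)`, `−X₀(−9/25, 5)` on the station segment `s ∈ [−276/425, −9/25]` per density (`…_of_apexStation5_twoEndObjectives`; target-slot, NO `K₂` input);
  the «L» (bottom `U = 5` + left edge `t′ = −23/50`, every source inside the box; `…_of_bottomEdge_and_leftEdge_targetSlot`); the LADDER of target-slot stations
  `U 0 = 5, …, U m = 17/2` (`…_of_apexLadder_targetSlot`). All hypotheses are producer deliverables (unconditional orbit-lower families on torus-limit
  ground-state classes); every theorem is CONDITIONAL BY NAME on them; no `sorry`.

References: D. J. Scalapino, S. R. White, S.-C. Zhang, PRB 47 (1993) 7995, §II [ScalapinoWhiteZhang1993]; T. Hazra, N. Verma, M. Randeria,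
PRX 9 (2019) 031049, eqs. (2)–(6) [HazraVermaRanderia2019]; T. Koma, H. Tasaki, J. Stat. Phys. 76 (1994) 745, §1 [KomaTasaki1994].
-/

noncomputable section

namespace Summit.Ventures.CertifiedManyBodySolver.Observables

open Set NonemptyInterval Filter Topology
open Summit.Ventures.CertifiedManyBodySolver.Downfold
open Summit.Ventures.CertifiedManyBodySolver.Certificates
open Literature.MathematicalPhysics.QuantumLattice Literature.MathematicalPhysics.QuantumLattice.ThermodynamicLimit
open Literature.Probability.LatticeModels
open Matrix HubbardWave0
open scoped BigOperators ComplexOrder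

/-! ## §1 Kinematic controls (node-free) -/

/-- **KINEMATIC CONTROL (node-free, zero solve): the shape IS inhabited at the kinematic bar κ₂₁ = 0.4877121 on `boxNdNiO2E_M21`** — the box word
`boxNdNiO2E_M21_stiffness_kinematic` discharges `StiffnessBoxCeilingBelow boxNdNiO2E_M21 (4877121/10⁷)`; the rung leaf asks for `2 %` less
(`ndnio2_M21_bar_arith`). A ceiling at the kinematic scale carries no interaction content. [cite: HazraVermaRanderia2019, eqs. (2)-(6)] -/
theorem stiffnessBoxCeilingBelow_boxNdNiO2E_M21_kinematic : StiffnessBoxCeilingBelow boxNdNiO2E_M21 (4877121 / 10000000) :=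
  stiffnessBoxCeilingBelow_of_holdsOn le_rfl boxNdNiO2E_M21_stiffness_kinematic

/-- **KINEMATIC CONTROL on the twin**: `StiffnessBoxCeilingBelow boxNdSrNiO2E_M22 (4509038/10⁷)` from `boxNdSrNiO2E_M22_stiffness_kinematic`.
[cite: HazraVermaRanderia2019, eqs. (2)-(6)] -/
theorem stiffnessBoxCeilingBelow_boxNdSrNiO2E_M22_kinematic : StiffnessBoxCeilingBelow boxNdSrNiO2E_M22 (4509038 / 10000000) :=
  stiffnessBoxCeilingBelow_of_holdsOn le_rfl boxNdSrNiO2E_M22_stiffness_kinematic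

/-! ## §2 One station `U_A = 5` with the two END objectives; the «L»; the ladder (bar-parametric + the leaf) -/

/-- The NdNiO₂ one-station geometry at the low-`U` edge `U_A = 5`: station factor `2 − 5/(17/2) = 24/17`, far source of the corner slot
`(−23/50)(24/17) = −276/425` (`≈ −0.6494`), of the inner slot `(−9/25)(24/17) = −216/425` (`≈ −0.5082`). [folklore] -/
theorem ndnio2_M21_station5_geometry :
    (2 : ℝ) - 5 / (17 / 2) = 24 / 17 ∧ (-23 / 50 : ℝ) * (24 / 17) = -(276 / 425) ∧ (-9 / 25 : ℝ) * (24 / 17) = -(216 / 425) := by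
  refine ⟨?_, ?_, ?_⟩ <;> norm_num

/-- **NdNiO₂ from ONE STATION `U_A = 5` read with the TWO END OBJECTIVES (no `K₂` input), at ANY bar.** For every density `x ∈ [213/250, 477/500]` two
unconditional orbit-lower families on the station segment `s ∈ [−276/425, −9/25]` (torus-limit ground-state classes at `(s, 5, x)`): `vP x s` for the
objective `−X₀(−23/50, 5)` and `vQ x s` for `−X₀(−9/25, 5)`, with the σ-chord price `−((−9/25 − σ)vP x s + (σ + 23/50)vQ x s)/(1/10) ≤ c` for every
target slot `σ ∈ [−23/50, −9/25]` and source `s ∈ [24σ/17, σ]`, and `c ≤ bar`: then `StiffnessBoxCeilingBelow boxNdNiO2E_M21 bar`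
(`ObsStiffnessSeqCeilingAt_on_box_of_apexStation_twoEndObjectives` per density). The station segment reaches `t′ ≈ −0.649`; the «L» / ladder editions
below trade it for `U`-segment bundles / more stations. [cite: KomaTasaki1994, §1] [cite: ScalapinoWhiteZhang1993, §II] -/
theorem stiffnessBoxCeilingBelow_boxNdNiO2E_M21_of_apexStation5_twoEndObjectives (vP vQ : ℝ → ℝ → ℝ) (bar c : ℚ) (hbar : c ≤ bar)
    (hP : ∀ x ∈ Set.Icc (213 / 250 : ℝ) (477 / 500), ∀ s ∈ Set.Icc (-(276 / 425) : ℝ) (-9 / 25),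
      ∀ (ω : InfVolFermionState 2) (Ls : ℕ → ℕ) (ψ : ∀ L, Fock (Orb (FermionTorus 2 L))),
      Tendsto Ls atTop atTop →
      (∀ j, IsGroundStateInSector (hubbardTorusTT' (Ls j) 1 s 5) (rectN x (Ls j)) 0 (ψ (Ls j))) →
      (∀ j, star (ψ (Ls j)) ⬝ᵥ ψ (Ls j) = 1) → ω.IsTorusLimitOf ψ Ls →
      vP x s ≤ ((Finset.univ : Finset (DihedralGroup 4)).card : ℝ)⁻¹ * ∑ g ∈ (Finset.univ : Finset (DihedralGroup 4)),
        (ω.expect (d4ShiftSet g 0 (Literature.Probability.LatticeModels.box 2 7))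
          (fermionEmbed (PolySite.d4Emb g 0 (Literature.Probability.LatticeModels.box 2 7)) (-oddMomentObsTT (-23 / 50) 5 0))).re)
    (hQ : ∀ x ∈ Set.Icc (213 / 250 : ℝ) (477 / 500), ∀ s ∈ Set.Icc (-(276 / 425) : ℝ) (-9 / 25),
      ∀ (ω : InfVolFermionState 2) (Ls : ℕ → ℕ) (ψ : ∀ L, Fock (Orb (FermionTorus 2 L))),
      Tendsto Ls atTop atTop →
      (∀ j, IsGroundStateInSector (hubbardTorusTT' (Ls j) 1 s 5) (rectN x (Ls j)) 0 (ψ (Ls j))) →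
      (∀ j, star (ψ (Ls j)) ⬝ᵥ ψ (Ls j) = 1) → ω.IsTorusLimitOf ψ Ls →
      vQ x s ≤ ((Finset.univ : Finset (DihedralGroup 4)).card : ℝ)⁻¹ * ∑ g ∈ (Finset.univ : Finset (DihedralGroup 4)),
        (ω.expect (d4ShiftSet g 0 (Literature.Probability.LatticeModels.box 2 7))
          (fermionEmbed (PolySite.d4Emb g 0 (Literature.Probability.LatticeModels.box 2 7)) (-oddMomentObsTT (-9 / 25) 5 0))).re)
    (hc : ∀ x ∈ Set.Icc (213 / 250 : ℝ) (477 / 500), ∀ σ ∈ Set.Icc (-23 / 50 : ℝ) (-9 / 25), ∀ s ∈ Set.Icc (σ * (24 / 17)) σ,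
      -((-9 / 25 - σ) / (-9 / 25 - -23 / 50) * vP x s + (σ - -23 / 50) / (-9 / 25 - -23 / 50) * vQ x s) ≤ ((c : ℚ) : ℝ)) :
    StiffnessBoxCeilingBelow boxNdNiO2E_M21 bar := by
  obtain ⟨e, eP, -⟩ := ndnio2_M21_station5_geometry
  refine stiffnessBoxCeilingBelow_boxNdNiO2E_M21_of_cellLeaf hbar fun tp htp U hU n hn => ?_
  exact ObsStiffnessSeqCeilingAt_on_box_of_apexStation_twoEndObjectives (p := -23 / 50) (q := -9 / 25) (UA := 5) (Umax := 17 / 2)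
    (n := n) (by norm_num) (by norm_num) (by norm_num) (by linarith [hn.1]) (by linarith [hn.2]) (vP n) (vQ n) c
    (fun s hs => hP n hn s (by rwa [e, eP] at hs)) (fun s hs => hQ n hn s (by rwa [e, eP] at hs))
    (fun σ hσ s hs => hc n hn σ hσ s (by rwa [e] at hs)) tp htp U hU

/-- **The rung leaf from ONE STATION `U_A = 5` with the two END objectives** (`c ≤ 0.4779578`). [cite: KomaTasaki1994, §1] [cite: ScalapinoWhiteZhang1993, §II] -/
theorem NdNiO2M21_StiffnessBoxCeiling_of_apexStation5_twoEndObjectives (vP vQ : ℝ → ℝ → ℝ) (c : ℚ) (hbar : c ≤ 4779578 / 10000000)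
    (hP : ∀ x ∈ Set.Icc (213 / 250 : ℝ) (477 / 500), ∀ s ∈ Set.Icc (-(276 / 425) : ℝ) (-9 / 25),
      ∀ (ω : InfVolFermionState 2) (Ls : ℕ → ℕ) (ψ : ∀ L, Fock (Orb (FermionTorus 2 L))),
      Tendsto Ls atTop atTop →
      (∀ j, IsGroundStateInSector (hubbardTorusTT' (Ls j) 1 s 5) (rectN x (Ls j)) 0 (ψ (Ls j))) →
      (∀ j, star (ψ (Ls j)) ⬝ᵥ ψ (Ls j) = 1) → ω.IsTorusLimitOf ψ Ls →
      vP x s ≤ ((Finset.univ : Finset (DihedralGroup 4)).card : ℝ)⁻¹ * ∑ g ∈ (Finset.univ : Finset (DihedralGroup 4)),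
        (ω.expect (d4ShiftSet g 0 (Literature.Probability.LatticeModels.box 2 7))
          (fermionEmbed (PolySite.d4Emb g 0 (Literature.Probability.LatticeModels.box 2 7)) (-oddMomentObsTT (-23 / 50) 5 0))).re)
    (hQ : ∀ x ∈ Set.Icc (213 / 250 : ℝ) (477 / 500), ∀ s ∈ Set.Icc (-(276 / 425) : ℝ) (-9 / 25),
      ∀ (ω : InfVolFermionState 2) (Ls : ℕ → ℕ) (ψ : ∀ L, Fock (Orb (FermionTorus 2 L))),
      Tendsto Ls atTop atTop →
      (∀ j, IsGroundStateInSector (hubbardTorusTT' (Ls j) 1 s 5) (rectN x (Ls j)) 0 (ψ (Ls j))) →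
      (∀ j, star (ψ (Ls j)) ⬝ᵥ ψ (Ls j) = 1) → ω.IsTorusLimitOf ψ Ls →
      vQ x s ≤ ((Finset.univ : Finset (DihedralGroup 4)).card : ℝ)⁻¹ * ∑ g ∈ (Finset.univ : Finset (DihedralGroup 4)),
        (ω.expect (d4ShiftSet g 0 (Literature.Probability.LatticeModels.box 2 7))
          (fermionEmbed (PolySite.d4Emb g 0 (Literature.Probability.LatticeModels.box 2 7)) (-oddMomentObsTT (-9 / 25) 5 0))).re)
    (hc : ∀ x ∈ Set.Icc (213 / 250 : ℝ) (477 / 500), ∀ σ ∈ Set.Icc (-23 / 50 : ℝ) (-9 / 25), ∀ s ∈ Set.Icc (σ * (24 / 17)) σ,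
      -((-9 / 25 - σ) / (-9 / 25 - -23 / 50) * vP x s + (σ - -23 / 50) / (-9 / 25 - -23 / 50) * vQ x s) ≤ ((c : ℚ) : ℝ)) :
    NdNiO2M21_StiffnessBoxCeiling :=
  stiffnessBoxCeilingBelow_boxNdNiO2E_M21_of_apexStation5_twoEndObjectives vP vQ _ c hbar hP hQ hc

/-- **NdNiO₂ from the «L» at any density, lever-free, at ANY bar.** For every density `x ∈ [213/250, 477/500]`: a BOTTOM target-slot family `valB x σ s`
(target slots `σ ∈ [−23/50, −9/25]`, sources `s ∈ [−23/50, σ]` on the classes at `(s, 5, x)`, objective `−X₀(σ, 5)`) and a LEFT-EDGE target-slot family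
`valL x σ U'` (`U' ∈ [5, 17/2]`, classes at `(−23/50, U', x)`, objective `−X₀(σ, U')`), both with `−val ≤ c`, and `c ≤ bar` ⇒
`StiffnessBoxCeilingBelow boxNdNiO2E_M21 bar` (`ObsStiffnessSeqCeilingAt_on_box_of_bottomEdge_and_leftEdge_targetSlot` per density). Every source lies
INSIDE the box (no `t′ ≈ −0.649` overhang). [cite: KomaTasaki1994, §1] [cite: ScalapinoWhiteZhang1993, §II] -/
theorem stiffnessBoxCeilingBelow_boxNdNiO2E_M21_of_bottomEdge_and_leftEdge_targetSlot (valB valL : ℝ → ℝ → ℝ → ℝ) (bar c : ℚ)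
    (hbar : c ≤ bar)
    (hB : ∀ x ∈ Set.Icc (213 / 250 : ℝ) (477 / 500), ∀ σ ∈ Set.Icc (-23 / 50 : ℝ) (-9 / 25), ∀ s ∈ Set.Icc (-23 / 50 : ℝ) σ,
      ∀ (ω : InfVolFermionState 2) (Ls : ℕ → ℕ) (ψ : ∀ L, Fock (Orb (FermionTorus 2 L))),
      Tendsto Ls atTop atTop →
      (∀ j, IsGroundStateInSector (hubbardTorusTT' (Ls j) 1 s 5) (rectN x (Ls j)) 0 (ψ (Ls j))) →
      (∀ j, star (ψ (Ls j)) ⬝ᵥ ψ (Ls j) = 1) → ω.IsTorusLimitOf ψ Ls →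
      valB x σ s ≤ ((Finset.univ : Finset (DihedralGroup 4)).card : ℝ)⁻¹ * ∑ g ∈ (Finset.univ : Finset (DihedralGroup 4)),
        (ω.expect (d4ShiftSet g 0 (Literature.Probability.LatticeModels.box 2 7))
          (fermionEmbed (PolySite.d4Emb g 0 (Literature.Probability.LatticeModels.box 2 7)) (-oddMomentObsTT σ 5 0))).re)
    (hcB : ∀ x ∈ Set.Icc (213 / 250 : ℝ) (477 / 500), ∀ σ ∈ Set.Icc (-23 / 50 : ℝ) (-9 / 25), ∀ s ∈ Set.Icc (-23 / 50 : ℝ) σ,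
      -valB x σ s ≤ ((c : ℚ) : ℝ))
    (hL : ∀ x ∈ Set.Icc (213 / 250 : ℝ) (477 / 500), ∀ σ ∈ Set.Icc (-23 / 50 : ℝ) (-9 / 25), ∀ U' ∈ Set.Icc (5 : ℝ) (17 / 2),
      ∀ (ω : InfVolFermionState 2) (Ls : ℕ → ℕ) (ψ : ∀ L, Fock (Orb (FermionTorus 2 L))),
      Tendsto Ls atTop atTop →
      (∀ j, IsGroundStateInSector (hubbardTorusTT' (Ls j) 1 (-23 / 50) U') (rectN x (Ls j)) 0 (ψ (Ls j))) →
      (∀ j, star (ψ (Ls j)) ⬝ᵥ ψ (Ls j) = 1) → ω.IsTorusLimitOf ψ Ls →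
      valL x σ U' ≤ ((Finset.univ : Finset (DihedralGroup 4)).card : ℝ)⁻¹ * ∑ g ∈ (Finset.univ : Finset (DihedralGroup 4)),
        (ω.expect (d4ShiftSet g 0 (Literature.Probability.LatticeModels.box 2 7))
          (fermionEmbed (PolySite.d4Emb g 0 (Literature.Probability.LatticeModels.box 2 7)) (-oddMomentObsTT σ U' 0))).re)
    (hcL : ∀ x ∈ Set.Icc (213 / 250 : ℝ) (477 / 500), ∀ σ ∈ Set.Icc (-23 / 50 : ℝ) (-9 / 25), ∀ U' ∈ Set.Icc (5 : ℝ) (17 / 2),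
      -valL x σ U' ≤ ((c : ℚ) : ℝ)) :
    StiffnessBoxCeilingBelow boxNdNiO2E_M21 bar := by
  refine stiffnessBoxCeilingBelow_boxNdNiO2E_M21_of_cellLeaf hbar fun tp htp U hU n hn => ?_
  exact ObsStiffnessSeqCeilingAt_on_box_of_bottomEdge_and_leftEdge_targetSlot (p := -23 / 50) (q := -9 / 25) (UA := 5)
    (Umax := 17 / 2) (n := n) (by norm_num) (by norm_num) (by norm_num) (by linarith [hn.1]) (by linarith [hn.2]) (valB n) (valL n) c
    (hB n hn) (hcB n hn) (hL n hn) (hcL n hn) tp htp U hU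

/-- **NdNiO₂ from a LADDER of target-slot stations** `U : ℕ → ℝ`, `U 0 = 5`, `U m = 17/2`, `U k ≤ U (k+1)` (`0 < m`), at ANY bar: for every density
`x ∈ [213/250, 477/500]` and station `k < m` a two-parameter family `val x k σ s` (objective `−X₀(σ, U_k)`, `σ ∈ [−23/50, −9/25]`,
`s ∈ [σ(2 − U_k/U_{k+1}), σ]` on the classes at `(s, U_k, x)`) with `−val ≤ c`, and `c ≤ bar` ⇒ `StiffnessBoxCeilingBelow boxNdNiO2E_M21 bar`
(`ObsStiffnessSeqCeilingAt_on_box_of_apexLadder_targetSlot` per density): `t′`-bundles only, overhangs as short as the ladder is dense, no `K₂` input.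
[cite: KomaTasaki1994, §1] [cite: ScalapinoWhiteZhang1993, §II] -/
theorem stiffnessBoxCeilingBelow_boxNdNiO2E_M21_of_apexLadder_targetSlot (U : ℕ → ℝ) {m : ℕ} (hm : 0 < m) (hU0 : U 0 = 5)
    (hUm : U m = 17 / 2) (hmono : ∀ k < m, U k ≤ U (k + 1)) (val : ℝ → ℕ → ℝ → ℝ → ℝ) (bar c : ℚ) (hbar : c ≤ bar)
    (h : ∀ x ∈ Set.Icc (213 / 250 : ℝ) (477 / 500), ∀ k < m, ∀ σ ∈ Set.Icc (-23 / 50 : ℝ) (-9 / 25),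
      ∀ s ∈ Set.Icc (σ * (2 - U k / U (k + 1))) σ,
      ∀ (ω : InfVolFermionState 2) (Ls : ℕ → ℕ) (ψ : ∀ L, Fock (Orb (FermionTorus 2 L))),
      Tendsto Ls atTop atTop →
      (∀ j, IsGroundStateInSector (hubbardTorusTT' (Ls j) 1 s (U k)) (rectN x (Ls j)) 0 (ψ (Ls j))) →
      (∀ j, star (ψ (Ls j)) ⬝ᵥ ψ (Ls j) = 1) → ω.IsTorusLimitOf ψ Ls →
      val x k σ s ≤ ((Finset.univ : Finset (DihedralGroup 4)).card : ℝ)⁻¹ * ∑ g ∈ (Finset.univ : Finset (DihedralGroup 4)),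
        (ω.expect (d4ShiftSet g 0 (Literature.Probability.LatticeModels.box 2 7))
          (fermionEmbed (PolySite.d4Emb g 0 (Literature.Probability.LatticeModels.box 2 7)) (-oddMomentObsTT σ (U k) 0))).re)
    (hc : ∀ x ∈ Set.Icc (213 / 250 : ℝ) (477 / 500), ∀ k < m, ∀ σ ∈ Set.Icc (-23 / 50 : ℝ) (-9 / 25),
      ∀ s ∈ Set.Icc (σ * (2 - U k / U (k + 1))) σ, -val x k σ s ≤ ((c : ℚ) : ℝ)) :
    StiffnessBoxCeilingBelow boxNdNiO2E_M21 bar := by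
  refine stiffnessBoxCeilingBelow_boxNdNiO2E_M21_of_cellLeaf hbar fun tp htp u hu n hn => ?_
  have hu' : u ∈ Set.Icc (U 0) (U m) := by rw [hU0, hUm]; exact hu
  exact ObsStiffnessSeqCeilingAt_on_box_of_apexLadder_targetSlot U hm (by rw [hU0]; norm_num) hmono (by norm_num)
    (by linarith [hn.1]) (by linarith [hn.2]) (val n) c (h n hn) (hc n hn) tp htp u hu'

end Summit.Ventures.CertifiedManyBodySolver.Observables

end
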